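import Summits.MatrixMultiplication.MatrixMultiplication.Theses.LevelGradedCohnUmans

/-!
# `Assembly` — graded pricing + a graded design family decide `ω(ℂ) = 2`

Route `MatrixMultiplication/LevelGradedCohnUmans`, item `stmt-MatrixMultiplication-7619` (assembly):

  `GradedPricing → GradedDesignFamily → MatrixMultiplication`.

Pure `ε`-bookkeeping.  `2 ≤ ω(ℂ)` is the flattening bound
`Literature.Computability.AlgebraicComplexity.omega_two_le`.  If `2 < ω := omega ℂ`, feed
`ε := ω − 2 > 0` to `GradedDesignFamily`: it yields a finite group `G`, a bi-invariant test space
`J ≤ ℂ^G` and a `J`-separated triple `X, Y, Z` with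
`Σ_{χ ∈ Irr G ∩ J} χ(1)^{2+ε} < (|X||Y||Z|)^{(2+ε)/3}`; since `2 + ε = ω`, the graded pricing of
the same triple, `(|X||Y||Z|)^{ω/3} ≤ Σ_{χ ∈ Irr G ∩ J} χ(1)^ω`, is contradicted.  Hence `ω ≤ 2`,
and `MatrixMultiplication ↔ ω(ℂ) = 2` (`MatrixMultiplication_iff`).  The proof replays the route's
deciding theorem `closes` against the literal route decl, without depending on it.
-/

-- single-conjunct summit: the mandated namespace `Summit.MatrixMultiplication.MatrixMultiplication.…`
-- repeats `MatrixMultiplication` (summit = sub-problem), which `linter.dupNamespace` would flag.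
set_option linter.dupNamespace false

namespace Summit.MatrixMultiplication.MatrixMultiplication.Theorems

open Summit.MatrixMultiplication.MatrixMultiplication.Theses.LevelGradedCohnUmans in
/-- **Assembly of route LevelGradedCohnUmans** (settles `stmt-MatrixMultiplication-7619`, exact route
signature `Summit.MatrixMultiplication.MatrixMultiplication.Theses.LevelGradedCohnUmans.Assembly`):
the finite-group graded pricing `GradedPricing` (Blasiak–Cohn–Grochow–Pratt–Umans 2024, Thm 2.2,
`R_sep` form) and the graded design family `GradedDesignFamily` together give `ω(ℂ) = 2`.
If `2 < ω`, the design at `ε := ω − 2` has graded budget `< (|X||Y||Z|)^{ω/3}`, while graded pricing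
of the same `J`-separated triple gives `(|X||Y||Z|)^{ω/3} ≤` budget — absurd; so `ω ≤ 2`, and
`2 ≤ ω` is `omega_two_le`. [folklore] -/
theorem levelGradedCohnUmans_assembly_proof :
    Summit.MatrixMultiplication.MatrixMultiplication.Theses.LevelGradedCohnUmans.Assembly := by
  unfold Summit.MatrixMultiplication.MatrixMultiplication.Theses.LevelGradedCohnUmans.Assembly
  intro hP hX
  rw [MatrixMultiplication_iff]
  refine le_antisymm (le_of_not_gt fun hω => ?_)
    (Literature.Computability.AlgebraicComplexity.omega_two_le ℂ)
  obtain ⟨G, _instG, _instF, J, X, Y, Z, hJ, hsep, hlt⟩ :=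
    hX (Literature.Computability.AlgebraicComplexity.omega ℂ - 2) (sub_pos.mpr hω)
  have hle := hP G J hJ X Y Z hsep
  have h2 : (2 : ℝ) + (Literature.Computability.AlgebraicComplexity.omega ℂ - 2)
      = Literature.Computability.AlgebraicComplexity.omega ℂ := by ring
  rw [h2] at hlt
  exact lt_irrefl _ (lt_of_lt_of_le hlt hle)

end Summit.MatrixMultiplication.MatrixMultiplication.Theorems
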